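import Summits.ResolutionOfSingularities.ResolutionOfSingularities.Theorems.FrobeniusLadderFRationalResolutionGaloisBaseChangeRegularCompletion
import Literature.AlgebraicGeometry.Resolution.AdicQuotient
import Mathlib.RingTheory.AdicCompletion.Completeness
import HarnessLib

/-!
# Crux `FrobeniusLadder.FRationalResolution` (stmt-ResolutionOfSingularities-15317), line `redirect`,
# stub `stub_diagonalizableQuotientResolution` — THE ONE-POINT OBLIGATION OF THE GALOIS ROUTE STATED INSIDE THE COMPLETE LOCAL RING

After `…GaloisBaseChangeRegularCompletion` (this generation) the one-point obligation at a twisted isolated singular point reads: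
a decomposition-stable `𝔔'`-primary ideal `I ⊆ B' = B ⊗_K K'` whose extension to `Ê = (B'_{𝔔'})^` has regular blow-up. Here the
ideal itself is moved into `Ê`: the obligation becomes a statement about the complete Noetherian local ring `Ê` (a `K`-form of the
split toric germ, memos MEMO-15317-leafhand2-g13 §3b / leafhand4-g7 §3(e)) together with the ring endomorphisms of `Ê` induced by the
decomposition group — the habitat of the remaining research item (S1) «equivariant centres».

* `map_comap_eq_of_pow_le` — `R` Noetherian local: an ideal `J ⊆ R̂` containing `𝔪̂ⁿ` is extended from `R` (`J = (J ∩ R) R̂`;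
  `R/𝔪ⁿ = R̂/𝔪ⁿR̂`, Mathlib `AdicCompletion.pow_smul_top_eq_ker_eval`);
* `exists_completedTwist` — for `σ` in the decomposition group of `𝔔'` the twist `1 ⊗ σ` extends to a ring endomorphism `τ` of
  `Ê` (`Localization.localRingHom` + tree `adicCompletionMap`), `τ ∘ (B' → Ê) = (B' → Ê) ∘ (1 ⊗ σ)`;
* **`hloc_of_stable_ideal_adicCompletion`** — `hloc` at the singular point from the one-point data `(K', 𝔔')` and a proper ideal
  `J ⊆ Ê` with `(𝔔'Ê)ⁿ = 𝔪̂ⁿ ⊆ J`, `Bl_J(Spec Ê)` REGULAR and `τ(J) ⊆ J` for some extension `τ` of each decomposition twist;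
* `hasResolution_of_stable_ideals_adicCompletion` — the scheme-side assembly in the same currency.

Honest label: plumbing toward ONE leaf stub (no stub, crux or summit closed). What remains is mathematical: an `𝔪̂`-primary ideal of
the complete local ring `Ê`, stable under the (finitely many) completed decomposition twists, with regular blow-up. No definitions,
no named facts, no sorry. [cite: Matsumura1987, Thm. 8.11; Thm. 8.14; Thm. 23.7 (i)] [cite: GortzWedhorn2020, Prop. 13.91 (2)]
[cite: StacksProject, Tag 05GG; Tag 09EB; Tag 0CDQ]
-/

noncomputable section

-- single-problem summit: the doubled namespace component is forced
set_option linter.dupNamespace false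

open CategoryTheory AlgebraicGeometry TopologicalSpace TensorProduct
open Literature.AlgebraicGeometry.Resolution
open Summit.ResolutionOfSingularities.ResolutionOfSingularities.Theorems.FRationalResolution

namespace Summit.ResolutionOfSingularities.ResolutionOfSingularities.Theorems.FRationalResolution.GaloisCompletedObligation

/-- **`𝔪̂`-primary ideals of `R̂` are extended from `R`.** For `R` Noetherian local and `J ⊆ R̂ = AdicCompletion 𝔪 R` with
`𝔪̂ⁿ ⊆ J`: `(J ∩ R) R̂ = J` (because `R → R̂/𝔪ⁿR̂ = R/𝔪ⁿ` is onto and `𝔪ⁿR̂ ⊆ J`). [cite: Matsumura1987, Thm. 8.11]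
[cite: StacksProject, Tag 05GG] -/
theorem map_comap_eq_of_pow_le {R : Type} [CommRing R] [IsNoetherianRing R] [IsLocalRing R]
    (J : Ideal (AdicCompletion (IsLocalRing.maximalIdeal R) R)) {n : ℕ}
    (hJ : IsLocalRing.maximalIdeal (AdicCompletion (IsLocalRing.maximalIdeal R) R) ^ n ≤ J) :
    (J.comap (algebraMap R (AdicCompletion (IsLocalRing.maximalIdeal R) R))).map
      (algebraMap R (AdicCompletion (IsLocalRing.maximalIdeal R) R)) = J := by
  -- `𝔪ⁿ R̂ ≤ J`
  have hpow : (IsLocalRing.maximalIdeal R ^ n).map (algebraMap R (AdicCompletion (IsLocalRing.maximalIdeal R) R)) ≤ J := by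
    rw [Ideal.map_pow, ← AdicCompletion.maximalIdeal_eq_map]
    exact hJ
  have hpow' : IsLocalRing.maximalIdeal R ^ n ≤ J.comap (algebraMap R (AdicCompletion (IsLocalRing.maximalIdeal R) R)) :=
    Ideal.map_le_iff_le_comap.mp hpow
  refine le_antisymm Ideal.map_comap_le fun j hj => ?_
  -- approximate `j` by an element of `R` modulo `𝔪ⁿ R̂`
  obtain ⟨r, hr⟩ := Submodule.mkQ_surjective (IsLocalRing.maximalIdeal R ^ n • ⊤ : Submodule R R)
    (AdicCompletion.eval (IsLocalRing.maximalIdeal R) R n j)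
  have hof : algebraMap R (AdicCompletion (IsLocalRing.maximalIdeal R) R) r =
      AdicCompletion.of (IsLocalRing.maximalIdeal R) R r := rfl
  have hker : j - algebraMap R (AdicCompletion (IsLocalRing.maximalIdeal R) R) r ∈
      (IsLocalRing.maximalIdeal R ^ n • ⊤ : Submodule R (AdicCompletion (IsLocalRing.maximalIdeal R) R)) := by
    rw [AdicCompletion.pow_smul_top_eq_ker_eval (IsNoetherian.noetherian _), LinearMap.mem_ker, map_sub, hof,
      AdicCompletion.eval_of, hr, sub_self]
  rw [Ideal.smul_top_eq_map, Submodule.restrictScalars_mem] at hker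
  -- `j - r ∈ 𝔪ⁿ R̂ ⊆ J`, so `r ∈ J ∩ R`
  have h1 : j - algebraMap R _ r ∈ J := hpow hker
  have h2 : algebraMap R (AdicCompletion (IsLocalRing.maximalIdeal R) R) r ∈ J := by
    have := J.sub_mem hj h1
    rwa [sub_sub_cancel] at this
  have h3 : algebraMap R (AdicCompletion (IsLocalRing.maximalIdeal R) R) r ∈
      (J.comap (algebraMap R _)).map (algebraMap R (AdicCompletion (IsLocalRing.maximalIdeal R) R)) :=
    Ideal.mem_map_of_mem _ (Ideal.mem_comap.mpr h2)
  have h4 : j - algebraMap R (AdicCompletion (IsLocalRing.maximalIdeal R) R) r ∈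
      (J.comap (algebraMap R _)).map (algebraMap R (AdicCompletion (IsLocalRing.maximalIdeal R) R)) :=
    Ideal.map_mono hpow' hker
  have := Ideal.add_mem _ h4 h3
  rwa [sub_add_cancel] at this

/-- **The decomposition twists extend to the complete local ring.** For `σ ∈ Gal(K'/K)` with `(1 ⊗ σ) 𝔔' = 𝔔'` there is a ring
endomorphism `τ` of `Ê = ((B ⊗_K K')_{𝔔'})^` with `τ (b̂) = ((1 ⊗ σ) b)^` for all `b ∈ B ⊗_K K'` (localize the twist at `𝔔'`,
`Localization.localRingHom`, then complete it, tree `adicCompletionMap`). [folklore] -/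
theorem exists_completedTwist {K K' B : Type} [Field K] [Field K'] [Algebra K K'] [CommRing B] [Algebra K B]
    (𝔔' : Ideal (B ⊗[K] K')) [h𝔔' : 𝔔'.IsPrime] (σ : K' ≃ₐ[K] K')
    (hσ : 𝔔'.map (Algebra.TensorProduct.map (AlgHom.id B B) (σ : K' →ₐ[K] K')) = 𝔔') :
    ∃ τ : AdicCompletion (IsLocalRing.maximalIdeal (Localization.AtPrime 𝔔')) (Localization.AtPrime 𝔔') →+*
        AdicCompletion (IsLocalRing.maximalIdeal (Localization.AtPrime 𝔔')) (Localization.AtPrime 𝔔'),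
      ∀ b : B ⊗[K] K',
        τ (algebraMap (B ⊗[K] K') _ b) =
          algebraMap (B ⊗[K] K') _ (Algebra.TensorProduct.map (AlgHom.id B B) (σ : K' →ₐ[K] K') b) := by
  -- the twist is bijective
  set tw : B ⊗[K] K' →ₐ[B] B ⊗[K] K' := Algebra.TensorProduct.map (AlgHom.id B B) (σ : K' →ₐ[K] K') with htw
  have hbij : Function.Bijective tw := by
    have heq : (tw : B ⊗[K] K' → B ⊗[K] K') =
        (Algebra.TensorProduct.congr (AlgEquiv.refl : B ≃ₐ[B] B) σ : B ⊗[K] K' → B ⊗[K] K') := by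
      funext x
      induction x using TensorProduct.induction_on with
      | zero => simp [tw]
      | tmul b y => simp [tw, Algebra.TensorProduct.map_tmul]
      | add x y hx hy => simp only [map_add, hx, hy]
    rw [heq]
    exact (Algebra.TensorProduct.congr (AlgEquiv.refl : B ≃ₐ[B] B) σ).bijective
  have hcomap : 𝔔' = 𝔔'.comap (tw : B ⊗[K] K' →+* B ⊗[K] K') := by
    conv_lhs => rw [← Ideal.comap_map_of_bijective (tw : B ⊗[K] K' →+* B ⊗[K] K') hbij (I := 𝔔')]
    exact congrArg _ (by exact_mod_cast hσ)
  -- localize at `𝔔'`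
  set φ := Localization.localRingHom 𝔔' 𝔔' (tw : B ⊗[K] K' →+* B ⊗[K] K') hcomap with hφ
  haveI : IsLocalHom φ := Localization.isLocalHom_localRingHom 𝔔' 𝔔' _ hcomap
  have hφ𝔪 : (IsLocalRing.maximalIdeal (Localization.AtPrime 𝔔')).map φ ≤
      IsLocalRing.maximalIdeal (Localization.AtPrime 𝔔') := by
    rw [Ideal.map_le_iff_le_comap]
    intro x hx
    rw [Ideal.mem_comap, IsLocalRing.mem_maximalIdeal]
    exact (map_mem_nonunits_iff φ x).mpr (IsLocalRing.mem_maximalIdeal _ |>.mp hx)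
  -- complete
  refine ⟨adicCompletionMap _ _ φ hφ𝔪, fun b => ?_⟩
  rw [AdicCompletion.algebraMap_apply, AdicCompletion.algebraMap_apply, adicCompletionMap_of, hφ,
    Localization.localRingHom_to_map]
  rfl

/-- **`hloc` FROM A STABLE `𝔪̂`-PRIMARY IDEAL OF THE COMPLETE LOCAL RING WITH REGULAR BLOW-UP.** Data as in
`…GaloisBaseChangeRegular.hloc_of_decomposition_stable_piece'` (`ι : Spec B → X` affine open over `K`, `𝔭` the isolated singular point,
`K'/K` finite Galois, `𝔔'` maximal over `𝔭`), and in `Ê = ((B ⊗_K K')_{𝔔'})^`: an ideal `J ≠ ⊤` with `(𝔔'Ê)ⁿ = 𝔪̂ⁿ ⊆ J`, stable under SOME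
extension `τ` to `Ê` of every decomposition twist (`(1 ⊗ σ) 𝔔' = 𝔔'`; the canonical extension exists, `exists_completedTwist`), with
`Bl_J(Spec Ê)` regular. Then `hloc` holds at `ι 𝔭`. Proof: `I := J ∩ (B ⊗_K K')` is `𝔔'`-primary, decomposition-stable, and
`I Ê = J` (`map_comap_eq_of_pow_le` + `IsLocalization.map_under`); conclude by `…GaloisBaseChangeRegularCompletion`.
[cite: Matsumura1987, Thm. 8.11; Thm. 8.14; Thm. 23.7 (i)] [cite: GortzWedhorn2020, Prop. 13.91 (2)] [cite: StacksProject, Tag 0CDQ; Tag 09EB] -/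
theorem hloc_of_stable_ideal_adicCompletion (K : Type) [Field K] (X : Scheme.{0}) [IsIntegral X]
    (f : X ⟶ Spec (.of K)) [LocallyOfFiniteType f]
    {B : Type} [CommRing B] [IsDomain B] [Algebra K B] [Algebra.FiniteType K B]
    (ι : Spec (.of B) ⟶ X) [IsOpenImmersion ι] (hι : ι ≫ f = Spec.map (CommRingCat.ofHom (algebraMap K B)))
    (𝔭 : Ideal B) [h𝔭 : 𝔭.IsMaximal] (h𝔭0 : 𝔭 ≠ ⊥)
    (hsing : ι ⟨𝔭, h𝔭.isPrime⟩ ∉ Scheme.regularLocus X)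
    (hregB : ∀ P : Spec (.of B), P.asIdeal ≠ 𝔭 → P ∈ Scheme.regularLocus (Spec (.of B)))
    (K' : Type) [Field K'] [Algebra K K'] [FiniteDimensional K K'] [IsGalois K K']
    (𝔔' : Ideal (B ⊗[K] K')) [h𝔔' : 𝔔'.IsMaximal] (h𝔔'𝔭 : 𝔔'.comap (algebraMap B (B ⊗[K] K')) = 𝔭)
    (J : Ideal (AdicCompletion (IsLocalRing.maximalIdeal (Localization.AtPrime 𝔔')) (Localization.AtPrime 𝔔')))
    {n : ℕ}
    (hpJ : 𝔔'.map (algebraMap (B ⊗[K] K')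
      (AdicCompletion (IsLocalRing.maximalIdeal (Localization.AtPrime 𝔔')) (Localization.AtPrime 𝔔'))) ^ n ≤ J)
    (hJp : J ≠ ⊤)
    (hDJ : ∀ σ : K' ≃ₐ[K] K',
      𝔔'.map (Algebra.TensorProduct.map (AlgHom.id B B) (σ : K' →ₐ[K] K')) = 𝔔' →
      ∃ τ : AdicCompletion (IsLocalRing.maximalIdeal (Localization.AtPrime 𝔔')) (Localization.AtPrime 𝔔') →+*
          AdicCompletion (IsLocalRing.maximalIdeal (Localization.AtPrime 𝔔')) (Localization.AtPrime 𝔔'),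
        (∀ b : B ⊗[K] K', τ (algebraMap (B ⊗[K] K') _ b) =
          algebraMap (B ⊗[K] K') _ (Algebra.TensorProduct.map (AlgHom.id B B) (σ : K' →ₐ[K] K') b)) ∧
        J.map τ ≤ J)
    (hregJ : Scheme.IsRegular (affineBlowup J)) :
    ∃ (V : X.Opens), ι ⟨𝔭, h𝔭.isPrime⟩ ∈ V ∧
      (∀ t : X, t ∉ Scheme.regularLocus X → t ∈ V → t = ι ⟨𝔭, h𝔭.isPrime⟩) ∧
      ∃ (Y : Scheme.{0}) (ρ : Y ⟶ V), IsProper ρ ∧ Scheme.IsRegular Y ∧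
        IsIso (ρ ∣_ (V.ι ⁻¹ᵁ ⟨Scheme.regularLocus X, isOpen_regularLocus_of_locallyOfFiniteType_field f⟩)) ∧
        Dense ((ρ ⁻¹ᵁ (V.ι ⁻¹ᵁ ⟨Scheme.regularLocus X,
          isOpen_regularLocus_of_locallyOfFiniteType_field f⟩) : Y.Opens) : Set Y) := by
  haveI : IsNoetherianRing B := Algebra.FiniteType.isNoetherianRing K B
  haveI : Algebra.FiniteType B (B ⊗[K] K') := inferInstance
  haveI : IsNoetherianRing (B ⊗[K] K') := Algebra.FiniteType.isNoetherianRing B (B ⊗[K] K')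
  haveI : IsNoetherianRing (Localization.AtPrime 𝔔') :=
    IsLocalization.isNoetherianRing 𝔔'.primeCompl (Localization.AtPrime 𝔔') inferInstance
  -- the composite structure map `B' → B'_{𝔔'} → Ê`
  have hfac : algebraMap (B ⊗[K] K')
      (AdicCompletion (IsLocalRing.maximalIdeal (Localization.AtPrime 𝔔')) (Localization.AtPrime 𝔔')) =
      (algebraMap (Localization.AtPrime 𝔔') _).comp (algebraMap (B ⊗[K] K') (Localization.AtPrime 𝔔')) :=
    RingHom.ext fun _ => rfl
  -- the descended ideal
  set I : Ideal (B ⊗[K] K') := J.comap (algebraMap (B ⊗[K] K')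
    (AdicCompletion (IsLocalRing.maximalIdeal (Localization.AtPrime 𝔔')) (Localization.AtPrime 𝔔'))) with hI
  have hmapQ : 𝔔'.map (algebraMap (B ⊗[K] K')
      (AdicCompletion (IsLocalRing.maximalIdeal (Localization.AtPrime 𝔔')) (Localization.AtPrime 𝔔'))) =
      IsLocalRing.maximalIdeal _ := by
    rw [hfac, ← Ideal.map_map, Localization.AtPrime.map_eq_maximalIdeal, ← AdicCompletion.maximalIdeal_eq_map]
  have hpJ' : IsLocalRing.maximalIdeal _ ^ n ≤ J := by
    rw [← hmapQ]
    exact hpJ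
  have hpI : 𝔔' ^ n ≤ I := by
    rw [hI, ← Ideal.map_le_iff_le_comap, Ideal.map_pow]
    exact hpJ
  have hIp : I ≤ 𝔔' := by
    intro x hx
    by_contra hx'
    have hu : IsUnit (algebraMap (B ⊗[K] K') (Localization.AtPrime 𝔔') x) :=
      IsLocalization.map_units (Localization.AtPrime 𝔔') (⟨x, hx'⟩ : 𝔔'.primeCompl)
    have hu' : IsUnit (algebraMap (B ⊗[K] K')
        (AdicCompletion (IsLocalRing.maximalIdeal (Localization.AtPrime 𝔔')) (Localization.AtPrime 𝔔')) x) := by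
      rw [hfac, RingHom.comp_apply]
      exact hu.map _
    exact hJp (Ideal.eq_top_of_isUnit_mem _ (Ideal.mem_comap.mp hx) hu')
  have hD : ∀ σ : K' ≃ₐ[K] K',
      𝔔'.map (Algebra.TensorProduct.map (AlgHom.id B B) (σ : K' →ₐ[K] K')) = 𝔔' →
      I.map (Algebra.TensorProduct.map (AlgHom.id B B) (σ : K' →ₐ[K] K')) ≤ I := by
    intro σ hσ
    obtain ⟨τ, hτ, hτJ⟩ := hDJ σ hσ
    rw [Ideal.map_le_iff_le_comap]
    intro x hx
    rw [Ideal.mem_comap, hI, Ideal.mem_comap, ← hτ]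
    exact hτJ (Ideal.mem_map_of_mem τ hx)
  have hreg : Scheme.IsRegular (affineBlowup ((I.map (algebraMap (B ⊗[K] K') (Localization.AtPrime 𝔔'))).map
      (algebraMap (Localization.AtPrime 𝔔')
        (AdicCompletion (IsLocalRing.maximalIdeal (Localization.AtPrime 𝔔')) (Localization.AtPrime 𝔔'))))) := by
    have e := IsLocalization.map_under 𝔔'.primeCompl (Localization.AtPrime 𝔔')
      (J.comap (algebraMap (Localization.AtPrime 𝔔')
        (AdicCompletion (IsLocalRing.maximalIdeal (Localization.AtPrime 𝔔')) (Localization.AtPrime 𝔔'))))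
    rw [Ideal.under_def, Ideal.comap_comap, ← hfac] at e
    have h1 : I.map (algebraMap (B ⊗[K] K') (Localization.AtPrime 𝔔')) =
        J.comap (algebraMap (Localization.AtPrime 𝔔') _) := e
    rw [h1, map_comap_eq_of_pow_le J hpJ']
    exact hregJ
  exact GaloisBaseChangeRegularCompletion.hloc_of_decomposition_stable_piece_of_adicCompletion K X f ι hι 𝔭 h𝔭0 hsing
    hregB K' 𝔔' h𝔔'𝔭 I hpI hIp hD hreg

/-- **THE GALOIS ROUTE IN THE COMPLETE LOCAL RINGS, SCHEME SIDE.** An integral `X` locally of finite type over a field `K` with finitely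
many singular points has a resolution of singularities as soon as every singular point is `ι 𝔭` for an affine open `Spec B ↪ X`
(`𝔭` maximal `≠ 0`, `Spec B ∖ {𝔭}` regular) carrying a finite Galois `K'/K`, a maximal `𝔔' ⊆ B ⊗_K K'` over `𝔭`, and a proper
ideal `J ⊇ (𝔔'Ê)ⁿ` of `Ê = ((B ⊗_K K')_{𝔔'})^` stable under extensions of the decomposition twists with `Bl_J(Spec Ê)` regular.
[cite: StacksProject, Tag 0CDQ; Tag 09EB] [cite: Kollar2007, §2.2] [cite: Matsumura1987, Thm. 8.11; Thm. 8.14] -/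
theorem hasResolution_of_stable_ideals_adicCompletion (K : Type) [Field K] (X : Scheme.{0}) [IsIntegral X]
    (f : X ⟶ Spec (.of K)) [LocallyOfFiniteType f] (hfin : (Scheme.regularLocus X)ᶜ.Finite)
    (hchart : ∀ s : X, s ∉ Scheme.regularLocus X →
      ∃ (B : Type) (_ : CommRing B) (_ : IsDomain B) (_ : Algebra K B) (_ : Algebra.FiniteType K B)
        (ι : Spec (.of B) ⟶ X) (_ : IsOpenImmersion ι)
        (_ : ι ≫ f = Spec.map (CommRingCat.ofHom (algebraMap K B)))
        (𝔭 : Ideal B) (h𝔭 : 𝔭.IsMaximal) (_ : 𝔭 ≠ ⊥) (_ : ι ⟨𝔭, h𝔭.isPrime⟩ = s)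
        (_ : ∀ P : Spec (.of B), P.asIdeal ≠ 𝔭 → P ∈ Scheme.regularLocus (Spec (.of B)))
        (K' : Type) (_ : Field K') (_ : Algebra K K') (_ : FiniteDimensional K K') (_ : IsGalois K K')
        (𝔔' : Ideal (B ⊗[K] K')) (_ : 𝔔'.IsMaximal)
        (J : Ideal (AdicCompletion (IsLocalRing.maximalIdeal (Localization.AtPrime 𝔔')) (Localization.AtPrime 𝔔')))
        (n : ℕ),
          𝔔'.comap (algebraMap B (B ⊗[K] K')) = 𝔭 ∧
          𝔔'.map (algebraMap (B ⊗[K] K')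
            (AdicCompletion (IsLocalRing.maximalIdeal (Localization.AtPrime 𝔔')) (Localization.AtPrime 𝔔'))) ^ n ≤ J ∧
          J ≠ ⊤ ∧
          (∀ σ : K' ≃ₐ[K] K',
            𝔔'.map (Algebra.TensorProduct.map (AlgHom.id B B) (σ : K' →ₐ[K] K')) = 𝔔' →
            ∃ τ : AdicCompletion (IsLocalRing.maximalIdeal (Localization.AtPrime 𝔔')) (Localization.AtPrime 𝔔') →+*
                AdicCompletion (IsLocalRing.maximalIdeal (Localization.AtPrime 𝔔')) (Localization.AtPrime 𝔔'),
              (∀ b : B ⊗[K] K', τ (algebraMap (B ⊗[K] K') _ b) =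
                algebraMap (B ⊗[K] K') _ (Algebra.TensorProduct.map (AlgHom.id B B) (σ : K' →ₐ[K] K') b)) ∧
              J.map τ ≤ J) ∧
          Scheme.IsRegular (affineBlowup J)) :
    Scheme.HasResolution X := by
  refine IsolatedGlue.hasResolution_of_finite_singularLocus_of_local K X f hfin fun s hs => ?_
  obtain ⟨B, _, _, _, _, ι, _, hι, 𝔭, h𝔭, h𝔭0, hιs, hregB, K', _, _, _, _, 𝔔', _, J, n, h𝔔'𝔭, hpJ, hJp, hDJ, hregJ⟩ :=
    hchart s hs
  subst hιs
  exact hloc_of_stable_ideal_adicCompletion K X f ι hι 𝔭 h𝔭0 hs hregB K' 𝔔' h𝔔'𝔭 J hpJ hJp hDJ hregJ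

end Summit.ResolutionOfSingularities.ResolutionOfSingularities.Theorems.FRationalResolution.GaloisCompletedObligation

end
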